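import Summits.NavierStokesRegularity.NavierStokesRegularity.Theorems.AxisymmetricExtremalityAxisymmetricKatoGlobalStubSeregin2020TypeIILemma22ExcisionCutoff
import Summits.NavierStokesRegularity.NavierStokesRegularity.Theorems.AxisymmetricExtremalityAxisymmetricKatoGlobalStubSeregin2020TypeIILemma22ExcisionEstimates
import Summits.NavierStokesRegularity.NavierStokesRegularity.Theorems.AxisymmetricExtremalityAxisymmetricKatoGlobalStubSeregin2020TypeIILemma22VeryWeakAxis
import HarnessLib

/-!
# Seregin 2020, Lemma 2.2 (after Nazarov–Uraltseva 2012): total cost of excising the singular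
# set from a test function — the five error integrals and the loss on the axis term

Helper toward the stub `stub_seregin2020TypeII` of the crux `AxisymmetricKatoGlobal` (= the named
fact `Literature.Analysis.FluidPDE.Seregin2020_axisymmetricSingularPoint_typeII`, G. Seregin,
Anal. Math. Phys. 10 (2020) Paper 46 = arXiv:2006.04140, Thm 2.1), reduced in the tree to the
corrected Lemma 2.2 (`hWH′`; Nazarov–Uraltseva 2012, Lemma 4.2 for the class 𝒱). The very weak
form (N–U (4.5)) is tested with `η = η₀ · G(∑ᵢ ψᵢ)` (sibling `…Lemma22ExcisionCutoff`), the
parabolic bumps `ψᵢ` of radii `rᵢ < 1` covering `S ∩ tsupport η₀` (Seregin 2020, class 𝒱 (i):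
`S` is `𝒫¹`-null). This file sums the per-bump costs (siblings `…ParabolicBumpIntegrals`,
`…ExcisionEstimates`) over the family:

* `excision_error_integrals_le` — the densities `∑ᵢ|∂ₜψᵢ|`, `∑ᵢ 1_K‖U‖‖Dψᵢ‖`, `∑ᵢ ϱ⁻¹‖Dψᵢ‖`,
  `∑ᵢ|Δψᵢ|`, `∑ᵢ‖Dψᵢ‖` are integrable with integrals `O(∑ᵢ rᵢ)` (explicit constants);
* `axis_integral_sub_le` — `∫∫_{axis} (η₀ - η) ≤ 16 ‖η₀‖_∞ ∑ᵢ rᵢ`;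
* `timeDeriv_slice_eq_zero_of_notMem`, `continuous_timeDeriv_slice` — small tools.

## References

* G. Seregin, Anal. Math. Phys. 10 (2020), Paper 46 = arXiv:2006.04140, Lemma 2.2, class 𝒱 (i)
  (arXiv p. 8). [Seregin2020]
* A. I. Nazarov, N. N. Uraltseva, St. Petersburg Math. J. 23 (2012) 93–115 = arXiv:1011.1888,
  proof of Lemma 4.2, (4.5)–(4.6). [NazarovUraltseva2012]
-/

-- the problem directory repeats the summit name (D-0017); core's `dupNamespace` linter fires
set_option linter.dupNamespace false

noncomputable section

open MeasureTheory Set Function Filter Topology TopologicalSpace Metric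
open scoped NNReal ENNReal InnerProductSpace Laplacian

namespace Summit.NavierStokesRegularity.NavierStokesRegularity.Theorems.AxisymmetricKatoGlobal.EulerScaling

open Literature.Analysis.FluidPDE Literature.Analysis.FluidPDE.Seregin2020
  Literature.Analysis.FluidPDE.SereginZajaczkowski2007

/-! ### Small tools -/

/-- The time derivative of a slice vanishes off the space–time support. [folklore] -/
theorem timeDeriv_slice_eq_zero_of_notMem {ψ : ℝ → EuclideanSpace ℝ (Fin 3) → ℝ} {t : ℝ} {x : EuclideanSpace ℝ (Fin 3)}
    (h : (t, x) ∉ tsupport (uncurry ψ)) : deriv (fun s => ψ s x) t = 0 := by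
  have h0 : uncurry ψ =ᶠ[𝓝 (t, x)] 0 := notMem_tsupport_iff_eventuallyEq.1 h
  have hc : Continuous fun s : ℝ => ((s, x) : ℝ × EuclideanSpace ℝ (Fin 3)) := continuous_id.prodMk continuous_const
  have h1 : (fun s => ψ s x) =ᶠ[𝓝 t] fun _ => (0 : ℝ) := (hc.tendsto t).eventually h0
  rw [h1.deriv_eq, deriv_const]

/-- The time derivative `(t, x) ↦ ∂ₜχ(t, x)` of a space–time test function is continuous. [folklore] -/
theorem continuous_timeDeriv_slice {V : Opens (ℝ × EuclideanSpace ℝ (Fin 3))} {χ : ℝ → EuclideanSpace ℝ (Fin 3) → ℝ}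
    (hχ : IsSpaceTimeTestOn V χ) : Continuous fun z : ℝ × EuclideanSpace ℝ (Fin 3) => deriv (fun s => χ s z.2) z.1 := by
  have hd := hχ.contDiff.continuous_fderiv (by simp)
  have hslice : ∀ z : ℝ × EuclideanSpace ℝ (Fin 3), deriv (fun s => χ s z.2) z.1 =
      fderiv ℝ (uncurry χ) z ((1 : ℝ), (0 : EuclideanSpace ℝ (Fin 3))) := by
    intro z
    have h1 : HasDerivAt (fun s : ℝ => ((s, z.2) : ℝ × EuclideanSpace ℝ (Fin 3))) ((1 : ℝ), (0 : EuclideanSpace ℝ (Fin 3))) z.1 :=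
      (hasDerivAt_id z.1).prodMk (hasDerivAt_const z.1 z.2)
    have h2 := ((hχ.contDiff.differentiable (by simp) (z.1, z.2)).hasFDerivAt).comp_hasDerivAt z.1 h1
    exact h2.deriv
  simp_rw [hslice]
  exact hd.clm_apply continuous_const

/-- **Total excision cost of a finite bump family.** For bumps `ψᵢ` of radii `0 < rᵢ < 1`
with the derivative constant `A`, a compact `K` with `‖U‖³ ∈ L¹(K)`, and the axis-drift constant
`C_ax`: the five error densities `∑ᵢ|∂ₜψᵢ|`, `∑ᵢ 1_K‖U‖‖Dψᵢ‖`, `∑ᵢ ϱ⁻¹‖Dψᵢ‖`, `∑ᵢ|Δψᵢ|`,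
`∑ᵢ‖Dψᵢ‖` are integrable on `ℝ × ℝ³` with integrals `≤ 135A∑rᵢ`, `A(∫_K‖U‖³ + 135)∑rᵢ`,
`A C_ax ∑rᵢ`, `135A∑rᵢ`, `135A∑rᵢ`. [folklore] -/
theorem excision_error_integrals_le {ι : Type*} (s : Finset ι) {z : ι → ℝ × EuclideanSpace ℝ (Fin 3)} {r : ι → ℝ}
    (hr : ∀ i ∈ s, 0 < r i ∧ r i < 1) {ψ : ι → ℝ → EuclideanSpace ℝ (Fin 3) → ℝ}
    (hψ : ∀ i ∈ s, ∀ t x, ψ i t x = cutoff (r i ^ 2) (t - (z i).1) * cutoff (r i) (x - (z i).2))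
    {A : ℝ} (hA0 : 0 ≤ A)
    (hA : ∀ i ∈ s, ∀ (t : ℝ) (x : EuclideanSpace ℝ (Fin 3)),
      |deriv (fun τ => ψ i τ x) t| ≤ A / r i ^ 2 ∧ ‖fderiv ℝ (ψ i t) x‖ ≤ A / r i ∧ |(Δ (ψ i t)) x| ≤ A / r i ^ 2)
    {Cax : ℝ} (hCax0 : 0 ≤ Cax)
    (hCax : ∀ (ρ t₀ : ℝ) (x₀ : EuclideanSpace ℝ (Fin 3)), 0 < ρ →
      ∫⁻ w in Icc (t₀ - 2 * ρ ^ 2) (t₀ + 2 * ρ ^ 2) ×ˢ closedBall x₀ (2 * ρ),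
        ENNReal.ofReal ((cylRadius w.2)⁻¹) ≤ ENNReal.ofReal (Cax * ρ ^ 4))
    {K : Set (ℝ × EuclideanSpace ℝ (Fin 3))} (hK : IsCompact K)
    {U : ℝ → EuclideanSpace ℝ (Fin 3) → EuclideanSpace ℝ (Fin 3)}
    (hU1 : Integrable (K.indicator fun w : ℝ × EuclideanSpace ℝ (Fin 3) => ‖U w.1 w.2‖))
    (hU3 : IntegrableOn (fun w : ℝ × EuclideanSpace ℝ (Fin 3) => ‖U w.1 w.2‖ ^ 3) K) :
    (Integrable (fun w : ℝ × EuclideanSpace ℝ (Fin 3) => ∑ i ∈ s, |deriv (fun τ => ψ i τ w.2) w.1|) ∧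
      ∫ w : ℝ × EuclideanSpace ℝ (Fin 3), ∑ i ∈ s, |deriv (fun τ => ψ i τ w.2) w.1| ≤ 135 * A * ∑ i ∈ s, r i) ∧
    (Integrable (fun w : ℝ × EuclideanSpace ℝ (Fin 3) => ∑ i ∈ s,
        K.indicator (fun w : ℝ × EuclideanSpace ℝ (Fin 3) => ‖U w.1 w.2‖) w * ‖fderiv ℝ (ψ i w.1) w.2‖) ∧
      ∫ w : ℝ × EuclideanSpace ℝ (Fin 3), ∑ i ∈ s,
        K.indicator (fun w : ℝ × EuclideanSpace ℝ (Fin 3) => ‖U w.1 w.2‖) w * ‖fderiv ℝ (ψ i w.1) w.2‖ ≤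
        A * ((∫ w in K, ‖U w.1 w.2‖ ^ 3) + 135) * ∑ i ∈ s, r i) ∧
    (Integrable (fun w : ℝ × EuclideanSpace ℝ (Fin 3) => ∑ i ∈ s, (cylRadius w.2)⁻¹ * ‖fderiv ℝ (ψ i w.1) w.2‖) ∧
      ∫ w : ℝ × EuclideanSpace ℝ (Fin 3), ∑ i ∈ s, (cylRadius w.2)⁻¹ * ‖fderiv ℝ (ψ i w.1) w.2‖ ≤
        A * Cax * ∑ i ∈ s, r i) ∧
    (Integrable (fun w : ℝ × EuclideanSpace ℝ (Fin 3) => ∑ i ∈ s, |(Δ (ψ i w.1)) w.2|) ∧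
      ∫ w : ℝ × EuclideanSpace ℝ (Fin 3), ∑ i ∈ s, |(Δ (ψ i w.1)) w.2| ≤ 135 * A * ∑ i ∈ s, r i) ∧
    (Integrable (fun w : ℝ × EuclideanSpace ℝ (Fin 3) => ∑ i ∈ s, ‖fderiv ℝ (ψ i w.1) w.2‖) ∧
      ∫ w : ℝ × EuclideanSpace ℝ (Fin 3), ∑ i ∈ s, ‖fderiv ℝ (ψ i w.1) w.2‖ ≤ 135 * A * ∑ i ∈ s, r i) := by
  have hKm : MeasurableSet K := hK.isClosed.measurableSet
  -- per-bump facts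
  have hcont : ∀ i ∈ s, Continuous (fun w : ℝ × EuclideanSpace ℝ (Fin 3) => deriv (fun τ => ψ i τ w.2) w.1) ∧
      Continuous (fun w : ℝ × EuclideanSpace ℝ (Fin 3) => fderiv ℝ (ψ i w.1) w.2) ∧
      Continuous (fun w : ℝ × EuclideanSpace ℝ (Fin 3) => (Δ (ψ i w.1)) w.2) :=
    fun i hi => parabolicBump_continuous_derivs (hψ i hi)
  have hbox : ∀ i ∈ s, ∀ (t : ℝ) (x : EuclideanSpace ℝ (Fin 3)),
      (t, x) ∉ Icc ((z i).1 - 2 * r i ^ 2) ((z i).1 + 2 * r i ^ 2) ×ˢ closedBall (z i).2 (2 * r i) →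
      ψ i t x = 0 ∧ deriv (fun τ => ψ i τ x) t = 0 ∧ fderiv ℝ (ψ i t) x = 0 ∧ (Δ (ψ i t)) x = 0 :=
    fun i hi => parabolicBump_derivs_eq_zero (hr i hi).1 (hψ i hi)
  have hboxc : ∀ i ∈ s, IsCompact (Icc ((z i).1 - 2 * r i ^ 2) ((z i).1 + 2 * r i ^ 2) ×ˢ closedBall (z i).2 (2 * r i)) :=
    fun i _ => isCompact_Icc.prod (isCompact_closedBall _ _)
  -- integrability of the single terms
  have iT : ∀ i ∈ s, Integrable (fun w : ℝ × EuclideanSpace ℝ (Fin 3) => |deriv (fun τ => ψ i τ w.2) w.1|) := fun i hi =>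
    ((hcont i hi).1.abs).integrable_of_hasCompactSupport
      (HasCompactSupport.intro (hboxc i hi) fun w hw => by simp [(hbox i hi w.1 w.2 hw).2.1])
  have iD : ∀ i ∈ s, Integrable (fun w : ℝ × EuclideanSpace ℝ (Fin 3) => ‖fderiv ℝ (ψ i w.1) w.2‖) := fun i hi =>
    ((hcont i hi).2.1.norm).integrable_of_hasCompactSupport
      (HasCompactSupport.intro (hboxc i hi) fun w hw => by simp [(hbox i hi w.1 w.2 hw).2.2.1])
  have iL : ∀ i ∈ s, Integrable (fun w : ℝ × EuclideanSpace ℝ (Fin 3) => |(Δ (ψ i w.1)) w.2|) := fun i hi =>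
    ((hcont i hi).2.2.abs).integrable_of_hasCompactSupport
      (HasCompactSupport.intro (hboxc i hi) fun w hw => by simp [(hbox i hi w.1 w.2 hw).2.2.2])
  have iU : ∀ i ∈ s, Integrable (fun w : ℝ × EuclideanSpace ℝ (Fin 3) =>
      K.indicator (fun w : ℝ × EuclideanSpace ℝ (Fin 3) => ‖U w.1 w.2‖) w * ‖fderiv ℝ (ψ i w.1) w.2‖) := by
    intro i hi
    have h := hU1.mul_bdd (hcont i hi).2.1.norm.aestronglyMeasurable
      (Eventually.of_forall fun w => show ‖‖fderiv ℝ (ψ i w.1) w.2‖‖ ≤ A / r i from by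
        rw [norm_norm]; exact (hA i hi w.1 w.2).2.1)
    exact h
  have iR : ∀ i ∈ s, Integrable (fun w : ℝ × EuclideanSpace ℝ (Fin 3) => (cylRadius w.2)⁻¹ * ‖fderiv ℝ (ψ i w.1) w.2‖) := by
    intro i hi
    set Bx := Icc ((z i).1 - 2 * r i ^ 2) ((z i).1 + 2 * r i ^ 2) ×ˢ closedBall (z i).2 (2 * r i) with hBx
    have hBm : MeasurableSet Bx := measurableSet_Icc.prod measurableSet_closedBall
    have hρ : Integrable (Bx.indicator fun w : ℝ × EuclideanSpace ℝ (Fin 3) => (cylRadius w.2)⁻¹) :=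
      (integrable_indicator_iff hBm).2 (integrableOn_inv_cylRadius_snd (hboxc i hi))
    have h := hρ.mul_bdd (hcont i hi).2.1.norm.aestronglyMeasurable
      (Eventually.of_forall fun w => show ‖‖fderiv ℝ (ψ i w.1) w.2‖‖ ≤ A / r i from by
        rw [norm_norm]; exact (hA i hi w.1 w.2).2.1)
    refine h.congr (Eventually.of_forall fun w => ?_)
    show Bx.indicator (fun w : ℝ × EuclideanSpace ℝ (Fin 3) => (cylRadius w.2)⁻¹) w * ‖fderiv ℝ (ψ i w.1) w.2‖ =
      (cylRadius w.2)⁻¹ * ‖fderiv ℝ (ψ i w.1) w.2‖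
    by_cases hw : w ∈ Bx
    · rw [indicator_of_mem hw]
    · rw [indicator_of_notMem hw, (hbox i hi w.1 w.2 hw).2.2.1, norm_zero, mul_zero, mul_zero]
  -- the single integral bounds
  have bT : ∀ i ∈ s, (∫ w : ℝ × EuclideanSpace ℝ (Fin 3), |deriv (fun τ => ψ i τ w.2) w.1|) ≤ 135 * A * r i :=
    fun i hi => (integral_bump_derivs_le (hr i hi).1 (hr i hi).2 (hψ i hi) hA0 (hA i hi)).1
  have bD : ∀ i ∈ s, (∫ w : ℝ × EuclideanSpace ℝ (Fin 3), ‖fderiv ℝ (ψ i w.1) w.2‖) ≤ 135 * A * r i :=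
    fun i hi => (integral_bump_derivs_le (hr i hi).1 (hr i hi).2 (hψ i hi) hA0 (hA i hi)).2.1
  have bL : ∀ i ∈ s, (∫ w : ℝ × EuclideanSpace ℝ (Fin 3), |(Δ (ψ i w.1)) w.2|) ≤ 135 * A * r i :=
    fun i hi => (integral_bump_derivs_le (hr i hi).1 (hr i hi).2 (hψ i hi) hA0 (hA i hi)).2.2
  have bU : ∀ i ∈ s, (∫ w : ℝ × EuclideanSpace ℝ (Fin 3),
      K.indicator (fun w : ℝ × EuclideanSpace ℝ (Fin 3) => ‖U w.1 w.2‖) w * ‖fderiv ℝ (ψ i w.1) w.2‖) ≤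
      A * ((∫ w in K, ‖U w.1 w.2‖ ^ 3) + 135) * r i := by
    intro i hi
    have e : (fun w : ℝ × EuclideanSpace ℝ (Fin 3) => K.indicator (fun w : ℝ × EuclideanSpace ℝ (Fin 3) => ‖U w.1 w.2‖) w *
        ‖fderiv ℝ (ψ i w.1) w.2‖) = K.indicator (fun w => ‖U w.1 w.2‖ * ‖fderiv ℝ (ψ i w.1) w.2‖) := by
      funext w
      by_cases hw : w ∈ K
      · rw [indicator_of_mem hw, indicator_of_mem hw]
      · rw [indicator_of_notMem hw, indicator_of_notMem hw, zero_mul]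
    rw [e, integral_indicator hKm]
    exact integral_norm_mul_norm_fderiv_bump_le hK hU3 (hr i hi).1 (hr i hi).2 (hψ i hi) hA0 (hA i hi)
  have bR : ∀ i ∈ s, (∫ w : ℝ × EuclideanSpace ℝ (Fin 3), (cylRadius w.2)⁻¹ * ‖fderiv ℝ (ψ i w.1) w.2‖) ≤ A * Cax * r i :=
    fun i hi => integral_inv_cylRadius_mul_norm_fderiv_bump_le hCax0 hCax (hr i hi).1 (hr i hi).2 (hψ i hi) hA0 (hA i hi)
  refine ⟨⟨integrable_finsetSum s iT, ?_⟩, ⟨integrable_finsetSum s iU, ?_⟩, ⟨integrable_finsetSum s iR, ?_⟩,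
    ⟨integrable_finsetSum s iL, ?_⟩, ⟨integrable_finsetSum s iD, ?_⟩⟩
  · rw [integral_finsetSum s iT, Finset.mul_sum]; exact Finset.sum_le_sum bT
  · rw [integral_finsetSum s iU, Finset.mul_sum]; exact Finset.sum_le_sum bU
  · rw [integral_finsetSum s iR, Finset.mul_sum]; exact Finset.sum_le_sum bR
  · rw [integral_finsetSum s iL, Finset.mul_sum]; exact Finset.sum_le_sum bL
  · rw [integral_finsetSum s iD, Finset.mul_sum]; exact Finset.sum_le_sum bD

/-- **The loss of the axis term under excision**: for `η = η₀ g` with `0 ≤ η₀ ≤ M₀` and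
`1 - g ≤ ∑ᵢ 1_{ψᵢ ≠ 0}`, `∫∫ (η₀ - η)(t,(0,0,x₃)) dx₃ dt ≤ 16 M₀ ∑ᵢ rᵢ` (`rᵢ < 1`). [folklore] -/
theorem axis_integral_sub_le {ι : Type*} (s : Finset ι) {z : ι → ℝ × EuclideanSpace ℝ (Fin 3)} {r : ι → ℝ}
    (hr : ∀ i ∈ s, 0 < r i ∧ r i < 1) {ψ : ι → ℝ → EuclideanSpace ℝ (Fin 3) → ℝ}
    (hψ : ∀ i ∈ s, ∀ t x, ψ i t x = cutoff (r i ^ 2) (t - (z i).1) * cutoff (r i) (x - (z i).2))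
    {σ : ℝ → EuclideanSpace ℝ (Fin 3) → ℝ} (hσ : ∀ t x, σ t x = ∑ i ∈ s, ψ i t x)
    {G : ℝ → ℝ} (hG : ∀ v, G v = Real.exp 2 * expNegInvGlue ((1 - v) / 2))
    {g : ℝ → EuclideanSpace ℝ (Fin 3) → ℝ} (hg : ∀ t x, g t x = G (σ t x))
    {η₀ η : ℝ → EuclideanSpace ℝ (Fin 3) → ℝ} (hη : ∀ t x, η t x = η₀ t x * g t x)
    {M₀ : ℝ} (hM₀0 : 0 ≤ M₀) (hM₀ : ∀ t x, η₀ t x ≤ M₀)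
    (h₀ : Integrable fun p : ℝ × ℝ => η₀ p.1 (meridianPoint (0, p.2)))
    (h₁ : Integrable fun p : ℝ × ℝ => η p.1 (meridianPoint (0, p.2))) :
    ∫ p : ℝ × ℝ, η₀ p.1 (meridianPoint (0, p.2)) ≤
      (∫ p : ℝ × ℝ, η p.1 (meridianPoint (0, p.2))) + 16 * M₀ * ∑ i ∈ s, r i := by
  classical
  have hr' : ∀ i ∈ s, 0 < r i := fun i hi => (hr i hi).1
  have hone := one_sub_excisionCutoff_le s hr' hψ hσ hG hg
  -- the traces of the boxes on the axis plane
  set Tr : ι → Set (ℝ × ℝ) := fun i => {p : ℝ × ℝ | ((p.1, meridianPoint (0, p.2)) : ℝ × EuclideanSpace ℝ (Fin 3)) ∈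
    Icc ((z i).1 - 2 * r i ^ 2) ((z i).1 + 2 * r i ^ 2) ×ˢ closedBall (z i).2 (2 * r i)} with hTr
  have hax : Continuous fun p : ℝ × ℝ => ((p.1, meridianPoint (0, p.2)) : ℝ × EuclideanSpace ℝ (Fin 3)) :=
    continuous_fst.prodMk ((contDiff_meridianPoint (n := (⊤ : ℕ∞))).continuous.comp
      (continuous_const.prodMk continuous_snd))
  have hTm : ∀ i, MeasurableSet (Tr i) := fun i =>
    (hax.measurable (measurableSet_Icc.prod measurableSet_closedBall))
  have hTvol : ∀ i ∈ s, volume (Tr i) ≤ ENNReal.ofReal (16 * r i ^ 3) := fun i _ =>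
    volume_axisTrace_parabolicBox_le (r i) (z i).1 (z i).2
  have hTfin : ∀ i ∈ s, volume (Tr i) < ∞ := fun i hi => (hTvol i hi).trans_lt ENNReal.ofReal_lt_top
  -- pointwise: `η₀ - η ≤ M₀ ∑ᵢ 1_{Trᵢ}` on the axis plane
  have hpt : ∀ p : ℝ × ℝ, η₀ p.1 (meridianPoint (0, p.2)) - η p.1 (meridianPoint (0, p.2)) ≤
      ∑ i ∈ s, (Tr i).indicator (fun _ => M₀) p := by
    intro p
    rw [hη, ← mul_one_sub]
    have h1 := hone p.1 (meridianPoint (0, p.2))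
    have h2 : ∑ i ∈ s, (if ψ i p.1 (meridianPoint (0, p.2)) ≠ 0 then (1 : ℝ) else 0) ≤
        ∑ i ∈ s, (Tr i).indicator (fun _ => (1 : ℝ)) p := by
      refine Finset.sum_le_sum fun i hi => ?_
      split_ifs with hne
      · have hb := (parabolicBump_props (hr' i hi) (hψ i hi)).2.2.2.2 _ _ hne
        have hmem : p ∈ Tr i := by
          refine ⟨⟨by linarith [(abs_lt.1 hb.1).1], by linarith [(abs_lt.1 hb.1).2]⟩, ?_⟩
          rw [mem_closedBall, dist_eq_norm]; exact hb.2.le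
        rw [indicator_of_mem hmem]
      · exact indicator_nonneg (fun _ _ => zero_le_one) _
    calc η₀ p.1 (meridianPoint (0, p.2)) * (1 - g p.1 (meridianPoint (0, p.2)))
        ≤ M₀ * ∑ i ∈ s, (Tr i).indicator (fun _ => (1 : ℝ)) p :=
          mul_le_mul (hM₀ _ _) (h1.trans h2) (by
            have := (excisionCutoff_props s hr' hψ hσ hG hg).2.2.2.2.1 p.1 (meridianPoint (0, p.2))
            linarith) hM₀0
      _ = ∑ i ∈ s, (Tr i).indicator (fun _ => M₀) p := by
          rw [Finset.mul_sum]
          refine Finset.sum_congr rfl fun i _ => ?_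
          by_cases hp : p ∈ Tr i
          · rw [indicator_of_mem hp, indicator_of_mem hp, mul_one]
          · rw [indicator_of_notMem hp, indicator_of_notMem hp, mul_zero]
  have hInd : ∀ i ∈ s, Integrable ((Tr i).indicator fun _ : ℝ × ℝ => M₀) := fun i hi =>
    (integrableOn_const (C := M₀) (hTfin i hi).ne).integrable_indicator (hTm i)
  have hdiff : (∫ p : ℝ × ℝ, η₀ p.1 (meridianPoint (0, p.2))) - ∫ p : ℝ × ℝ, η p.1 (meridianPoint (0, p.2)) ≤
      16 * M₀ * ∑ i ∈ s, r i := by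
    rw [← integral_sub h₀ h₁]
    refine (integral_mono (h₀.sub h₁) (integrable_finsetSum s hInd) hpt).trans ?_
    rw [integral_finsetSum s hInd, Finset.mul_sum]
    refine Finset.sum_le_sum fun i hi => ?_
    rw [integral_indicator_const _ (hTm i), smul_eq_mul, measureReal_def]
    have hv : (volume (Tr i)).toReal ≤ 16 * r i ^ 3 := by
      have := ENNReal.toReal_mono ENNReal.ofReal_ne_top (hTvol i hi)
      rwa [ENNReal.toReal_ofReal (by have := (hr i hi).1; positivity)] at this
    have hr3 : r i ^ 3 ≤ r i := by
      have := pow_le_pow_of_le_one (hr i hi).1.le (hr i hi).2.le (by norm_num : 1 ≤ 3)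
      rwa [pow_one] at this
    nlinarith [mul_le_mul_of_nonneg_left hr3 hM₀0]
  linarith

end Summit.NavierStokesRegularity.NavierStokesRegularity.Theorems.AxisymmetricKatoGlobal.EulerScaling

end
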